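import Summits.AtomisticToContinuum.HydrodynamicLimit.Theses.AntiMazurCoboundaries
import Literature.MathematicalPhysics.KineticTheory.HardSphereEulerProofs
-- landed NEGATIVE lemmas this line is checked against (none of the five stubs is an instance they refute); the other
-- BGK negatives (`Negative.{Orthogonality,OrthMomentum,Degenerate}`) were read, not imported (build-queue independence):
import Summits.AtomisticToContinuum.HydrodynamicLimit.Theorems.ShearStressHalfDrude.Negative.WithoutOrth
import Summits.AtomisticToContinuum.HydrodynamicLimit.Theorems.ShearStressHalfDrude.Negative.FalseForAllN
import Summits.AtomisticToContinuum.HydrodynamicLimit.Theorems.BoltzmannGreenKubo.Negative.ForallN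
import Summits.AtomisticToContinuum.HydrodynamicLimit.Theorems.BoltzmannGreenKubo.Negative.AllWindows

/-!
# Line `cutoff-compactness-net` for crux `AntiMazurCoboundaries.ShearStressHalfDrude`
# (stmt-AtomisticToContinuum-14136) — planner's CHECKED skeleton (crux-plan round 1; gen 2, 2026-08-16)

Idea card `Cruxes/ShearStressHalfDrude/Ideas/cutoff-compactness-net.md` (ideator 2; triage r1-1/2/3: pass ×3,
"the sharpest structural finding of the round", F1 of TRIAGE-r1-3). Line card: `Lines/cutoff-compactness-net.md`.
Gen 2 supersedes the gen-0 file at the same path: the five registered stub SIGNATURES are unchanged byte for byte;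
what is new is the shape of the composition (hypothesis form, genuinely `sorry`-free, with a named WAYPOINT) and the
pointers to the `BoltzmannGreenKubo/Negative/*` infrastructure that landed after gen 0.

THE LINE. The crux asks `∃σ₀ ∀σ<σ₀ ∀e₁⊥e₂ ∀A>0 ∀φ ∃τ ∃N₀ ∀N≥N₀ ∀Φ : V_N(τ; φ⊗g_{e₁,e₂,A}) ≤ ½·(N+1)∫φ²‖g‖²_γ`
(`V_N` = Gibbs second moment of the kinetic-window average of `F = Σᵢ φ(xᵢ)g(wᵢ)`). The window functional is
EXACTLY Lipschitz in the one-body observable `g ↦ F_{φ⊗g}` (linear) for the static norm `√((N+1)∫φ²)·‖·‖_{L²(γ)}`,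
uniformly in `N, σ, Φ, h` (`stub_netLipschitz`, static + Jensen, provable now). Hence the quantifier `∃σ₀ … ∀A`
costs only a FINITE relative `L²(γ)`-net of the cone of cutoff stresses with `A ≥ A₁` (`stub_cutoffNet`, pure
Gaussian geometry: the normalised family is norm-precompact, `ĝ_A → ŵ₁ŵ₂` as `A → ∞`), and on `A ≥ A₁` the crux at
`φ ≡ 1` follows from FINITELY MANY instances of dilute-corner window decay (`stub_diluteCornerDecay` = the route's
rank-4 crux `BoltzmannGreenKubo` (13985) at `φ ≡ 1` for one cutoff stress, one-sided, with `σ₀` AFTER the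
observable and the tolerance — the hardest stub, the BGSS-locality core); the modulation `φ` is removed at FIXED
`σ` by first-moment locality (`stub_frozenModulation`, `N₀` may depend on `φ`, so `σ₀` stays `φ`-free); the
non-compact end `A → 0` (`ĝ_A ⇀ 0`) is the genuine residual with `σ₀` BEFORE `A`: near-rest spheres are ABSORBED
by one collision (`stub_absorptionCorner`, tagged-sphere grade).

COMPOSITION (§ Composition; the two waypoints are in hypothesis form and `sorry`-free, axioms
`propext / Classical.choice / Quot.sound`; no local `def` of a proposition anywhere in the file, so waypoints and
composition are landable verbatim next to the stubs):
* `compactRange_of_stubs : S1 → S2 → S3 → S4 → (compact-range bound)` — the COMPACT-RANGE WAYPOINT: for EVERY budget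
  `r > 0` and EVERY `A₁ > 0` the crux's functional is `≤ r·(N+1)∫φ²‖g‖²` on `A ≥ A₁` with `σ₀ = σ₀(a,θ,u₀,A₁,r)`
  chosen before `e₁, e₂, A, φ` (constants: net `ε = r/8` with norm factor `2`, decay fraction `r/8`, Minkowski
  `δ = 1`, modulation `η = r/4`: `2·2·r/8 + 2·r/8 + r/4 = r`). After unfolding its local abbreviations it is (a
  strengthening of: no upper cap on `A`) the stub the sibling line `velocity-resampling-cutoff` DELEGATES to this one
  (`VelocityResamplingCutoff.CompactCutoffDrude`, its stub 4, "do not staff twice") — one proof of S1–S4 serves both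
  lines; the third line (`fixed-budget-signed-hierarchy`) runs the same `A`-compactness in the two-time ENVELOPE
  currency (`CutoffCompactification`), which this window-level waypoint does not discharge.
* `cornerHalf_of_stubs : S4 → S5 → (corner bound ½)` — the CORNER WAYPOINT: the crux's bound `½` for `A ≤ A₁` (S5's
  `A₁`) and every `φ` (S5 at `φ ≡ 1`, then S4 at `η = ¼`).
* `ShearStressHalfDrude_of : ShearStressHalfDrude` — the audited name (type LITERALLY the route decl; the ONLY
  declaration here concluding the crux; no hypotheses): `σ₀ := min(½, σ_co, σ_cr)` with `σ_cr` the compact-range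
  threshold at `(A₁, r = ½)`, then a case split `A ≤ A₁` / `A₁ < A`. Its `sorryAx` enters through the registered
  `stub_*` only, and elaborating `compactRange_of_stubs stub_netLipschitz …` / `cornerHalf_of_stubs stub_frozenModulation
  stub_absorptionCorner` inside it makes the kernel certify that each waypoint hypothesis is, token for token, the
  registered stub signature (no drift possible).

DISPROOF USED (`Cruxes/ShearStressHalfDrude/Disproof.lean`, cycle 1 rev 2, + landed `Theorems/…/Negative/`):
* `shearStressHalfDrudeAllN_false` / `not_shearStressHalfDrudeAllN` (collisions load-bearing): honoured — every
  dynamical stub (3, 4, 5) concludes `∃ N₀ ∀ N ≥ N₀`, and the decay consumed is collisional (stub 3's window is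
  `s/(σ²√θ)` kinetic units, stub 5's mechanism is one collision of a near-rest sphere); nothing is claimed at `σ = 0`.
* `WO.shearStressHalfDrudeWithoutOrth_false` (centring load-bearing): honoured — `e₁ ⊥ e₂` is a hypothesis of stubs
  2–5, and stub 1 carries `∫ g dγ = ∫ g' dγ = 0` explicitly (it is what makes the static identity exact); the
  composition PROVES the centring of every cutoff stress (`integral_cutoff_eq_zero`, reflection in `(ℝ∙e₁)ᗮ`).
* `ShearStressHalfDrudeTauUniformInSigma` (τ before σ: false on paper): honoured — stub 3's window is
  `τ = s/(σ²√θ)` (13985's `h`), stubs 4/5 take `τ` after `σ`.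
* `ShearStressHalfDrudeUniform` (one τ for all `A, φ, e`: plausible): compatible — the net is finite, so the line
  would give `τ = max_k s_k/(σ²√θ) ∨ τ_abs` at no extra cost once stub 5's `τ` is uniform in `A ≤ A₁`.
* `half_lt_singleLagFloor`: no corrector appears anywhere in this line.
* BGK negatives (`Theorems/BoltzmannGreenKubo/Negative/{ForallN,AllWindows,Orthogonality,OrthMomentum,Degenerate}`):
  stub 3 keeps `∃N₀` (ForallN), keeps the window EXISTENTIAL `∃ s` (AllWindows: the threshold `s₀` of 13985 is
  load-bearing), keeps `e₁ ⊥ e₂` (its `g` is `γ`-orthogonal to `span(1,v,|v|²)` by parity — Orthogonality,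
  OrthMomentum) and keeps `0 < a`, `0 < θ` strict (Degenerate).
* `ledger negatives --problem AtomisticToContinuum`: no stub coincides with or implies a refuted statement (all
  observables are explicit smooth compactly supported functions; all measures of sets are under `G_N ≪ Liouville`).

All five stubs are stated over TREE VOCABULARY ONLY (no local definition occurs anywhere in this file), so each can
be landed verbatim as `Theorems/ShearStressHalfDrude<Stub>.lean` with `--supports stmt-AtomisticToContinuum-14136`
(copy the `open` lines below), and so can the two waypoints and the composition once the stubs they consume are in.
-/

noncomputable section

namespace Summit.AtomisticToContinuum.HydrodynamicLimit.Cruxes.ShearStressHalfDrude.CutoffCompactnessNet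

open MeasureTheory ProbabilityTheory Filter Set
open scoped ENNReal InnerProductSpace BigOperators
open Literature.Analysis.FluidPDE Literature.MathematicalPhysics.KineticTheory
open Summit.AtomisticToContinuum.HydrodynamicLimit.Theses.AntiMazurCoboundaries (ShearStressHalfDrude)

/-! ## The stubs (S1–S5) — the registered obligations of the line -/

/-- **S1 — NET LIPSCHITZ (exact, static; provable now; size M).** For centred bounded continuous one-body
observables `g, g'`, any continuous modulation `φ`, any window `h > 0`, any `N, σ ≤ 1/2, Φ` and any `δ > 0`:
`V(φ⊗g) ≤ (1+δ)·V(φ⊗g') + (1+δ⁻¹)·(N+1)·∫φ²·‖g−g'‖²_{L²(γ)}` — the `δ`-form of Minkowski (no square roots, no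
`toReal`), i.e. `√V` is 1-Lipschitz in `g` for the static norm. Proof sketch: `F_{φ⊗g} = F_{φ⊗g'} + F_{φ⊗(g−g')}`
and the window average is linear, so pointwise `(x+y)² ≤ (1+δ)x² + (1+δ⁻¹)y²`; then Jensen in `s` + invariance
of `G_N` under `Φ_s` give `∫(h⁻¹∫₀ʰ F_k∘Φ_s)² dG_N ≤ ∫ F_k² dG_N` — this ceiling is LANDED for velocity
observables at profiles `(1,0,1)` as `BoltzmannGreenKuboAllWindows.integral_sq_window_le`
(`Theorems/BoltzmannGreenKubo/Negative/AllWindows`, with `sq_avg_le_avg_sq`, the Fubini/stationarity plumbing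
`Negative/TimeAverage.integral_window_eq`, `Negative/Stationarity.measurePreserving_flow_localGibbsLaw`,
`Negative/JointMeasurability.measurable_flowMod`) and only needs the modulation `φ(xᵢ(s))` threaded through;
and the EXACT static identity `∫ F_{φ⊗k}² dG_N = (N+1)∫φ²‖k‖²_γ` for centred `k` (velocities i.i.d. `γ` and
independent of positions under `G_N` — `Negative/PiStatics.map_velOf_localGibbsLaw`, cross terms vanish as in
`Negative/AllWindows.integral_sum_sq`; one-point position marginal uniform by torus translation invariance of
the hard-core weight, `volume T3 = 1`). Both lintegrals are finite (bounded integrands, probability measure), so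
this is the real inequality. Shared with the sibling lines (`CutoffContinuity`, `StaticShearVariance`). -/
theorem stub_netLipschitz :
    ∀ (σ a θ : ℝ) (u₀ : V3), 0 < σ → σ ≤ 1 / 2 → 0 < a → 0 < θ →
    ∀ (N : ℕ) (Φ : HardSphereFlow (Torus.geometry (Fin 3)) (hsDiameter σ N) (N + 1)) (h : ℝ), 0 < h →
    ∀ (φ : T3 → ℝ) (g g' : V3 → ℝ), Continuous φ → Continuous g → Continuous g' →
      (∃ K : ℝ, ∀ v, |g v| ≤ K) → (∃ K : ℝ, ∀ v, |g' v| ≤ K) →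
      ∫ v, g v ∂stdGaussian V3 = 0 → ∫ v, g' v ∂stdGaussian V3 = 0 →
    ∀ δ : ℝ, 0 < δ →
      ∫⁻ z, ENNReal.ofReal ((h⁻¹ * ∫ s in (0 : ℝ)..h,
          ∑ i, φ (Φ.flow s z i).1 * g ((Real.sqrt θ)⁻¹ • ((Φ.flow s z i).2 - u₀))) ^ 2)
        ∂(localGibbsLaw σ (fun _ => a) (fun _ => u₀) (fun _ => θ) N Φ) ≤
      ENNReal.ofReal (1 + δ) *
        ∫⁻ z, ENNReal.ofReal ((h⁻¹ * ∫ s in (0 : ℝ)..h,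
          ∑ i, φ (Φ.flow s z i).1 * g' ((Real.sqrt θ)⁻¹ • ((Φ.flow s z i).2 - u₀))) ^ 2)
        ∂(localGibbsLaw σ (fun _ => a) (fun _ => u₀) (fun _ => θ) N Φ) +
      ENNReal.ofReal ((1 + δ⁻¹) * (((N : ℝ)) + 1) * (∫ x, φ x ^ 2) *
        ∫ v, (g v - g' v) ^ 2 ∂stdGaussian V3) := by
  sorry

/-- **S2 — FINITE NET OF THE CUTOFF CONE (pure Gaussian geometry; provable now; size M).** For every `A₁ > 0`
and `ε > 0` there are finitely many cutoff stresses `g_k = g_{E₁ k, E₂ k, A_k}` (`E₁ k ⊥ E₂ k`, `A_k > 0` finite)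
such that every cutoff stress `g = g_{e₁,e₂,A}` with `e₁ ⊥ e₂` and `A ≥ A₁` is, up to a scalar `c`, within
RELATIVE squared `L²(γ)`-distance `ε` of some `g_k`, with `‖c·g_k‖² ≤ 2‖g‖²`. Proof sketch: `g_{e₁,e₂,A} =
‖e₁‖‖e₂‖·g_{ê₁,ê₂,A}` (degree-2 homogeneity; `e₁ = 0` or `e₂ = 0` gives `g = 0`, served by `c = 0` — so take
`n ≥ 1`); the normalised family `(ê₁, ê₂, A) ↦ g/‖g‖_γ` is continuous on the compact Stiefel manifold × `[A₁, ∞]`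
(dominated convergence; at `A = ∞` the limit is `ŵ₁ŵ₂`, the tail `∫_{|w|≥A} w₁²w₂² dγ → 0` is an explicit
Gaussian moment; `‖g_{ê,A}‖_γ > 0` since `g = ½t²` at `w = t(ê₁+ê₂)/√2`, `t < A`), hence its image is compact,
hence totally bounded; replace a net point at `A = ∞` by a large finite `A`; `c := ‖g‖/‖g_k‖`, so that
`‖g − c g_k‖ = ‖g‖·‖ĝ − ĝ_k‖ ≤ √ε‖g‖` and `‖c g_k‖² = ‖g‖² ≤ 2‖g‖²`. Mathlib: `stdGaussian_map` (isometry
invariance), `TotallyBounded`, `IsCompact.finite_cover_balls`, `tendsto_integral_of_dominated_convergence`. -/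
theorem stub_cutoffNet :
    ∀ A₁ : ℝ, 0 < A₁ → ∀ ε : ℝ, 0 < ε →
    ∃ (n : ℕ) (E₁ E₂ : Fin n → V3) (Ac : Fin n → ℝ),
      (∀ k, inner ℝ (E₁ k) (E₂ k) = 0 ∧ 0 < Ac k) ∧
      ∀ (e₁ e₂ : V3), inner ℝ e₁ e₂ = 0 → ∀ A : ℝ, A₁ ≤ A →
      ∀ g : V3 → ℝ, (g = fun w => inner ℝ e₁ w * inner ℝ e₂ w * (1 - Real.smoothTransition (‖w‖ ^ 2 / A ^ 2 - 1))) →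
        ∃ (k : Fin n) (c : ℝ),
          ∫ v, (g v - c * (inner ℝ (E₁ k) v * inner ℝ (E₂ k) v *
              (1 - Real.smoothTransition (‖v‖ ^ 2 / (Ac k) ^ 2 - 1)))) ^ 2 ∂stdGaussian V3 ≤
            ε * ∫ v, g v ^ 2 ∂stdGaussian V3 ∧
          c ^ 2 * ∫ v, (inner ℝ (E₁ k) v * inner ℝ (E₂ k) v *
              (1 - Real.smoothTransition (‖v‖ ^ 2 / (Ac k) ^ 2 - 1))) ^ 2 ∂stdGaussian V3 ≤
            2 * ∫ v, g v ^ 2 ∂stdGaussian V3 := by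
  sorry

/-- **S3 — DILUTE-CORNER WINDOW DECAY at `φ ≡ 1` for ONE cutoff stress (the HARDEST stub; size L–XL).**
For every cutoff stress `g = g_{e₁,e₂,A}` (`e₁ ⊥ e₂`, `A > 0`) and every fraction `r > 0` there is a kinetic
window `s` (in units `t₀ = ℓ/(σ²√θ)`, exactly the `h` of `BoltzmannGreenKubo`) and a `σ₀ = σ₀(e₁,e₂,A,r)` such that
for `σ < σ₀`, uniformly in `N ≥ N₀` and in the flow, the unmodulated window second moment is `≤ r·(N+1)‖g‖²_γ`.
`σ₀` comes AFTER the observable and the tolerance — this is why it is easier than the crux: it is the one-sided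
`φ ≡ 1` special case of the route's typed rank-4 crux `BoltzmannGreenKubo` (stmt-13985): from 13985 at
`η = r‖g‖²/2` (for `‖g‖_γ > 0`; `e₁ = 0` or `e₂ = 0` gives `g = 0` and `0 ≤ 0`), any
`s ≥ max(s₀, (2·dirichletFormInv L g + η)/(r‖g‖²))` works (`dirichletFormInv L g` is a finite real — `≤ ‖g‖²/λ` by
the PROVED gap `le_neg_maxwellianInner_hardSphereLinearizedOp_of_orthogonal_holds` and
`bddAbove_range_dirichlet_of_orthogonal_holds`, though finiteness is all that is used), plus the parity fact
`g ⊥ span(1, v, |v|²)` in `L²(γ)` (reflections in `(ℝ∙e₁)ᗮ`, `(ℝ∙e₂)ᗮ`; for the `⟪b,v⟫` term split `b` along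
`e₁` and `e₁ᗮ`; cf. `gB_orth` in `Negative/ForallN`) and finiteness of the lintegral (bounded integrand, so the
`toReal` in 13985 is honest). Directly: BGSSCPAM2023 Thm 1.1 / BodineauEtAl2024 Thm 1.2 (covariance of the
equilibrium fluctuation field → linearised Boltzmann, our `g ⊗ 1` is an admissible test function; in-tree named
fact `fluctuationCovariance_tendsto`) made uniform in the domain measured in mean free paths (`N → ∞` FIRST at
fixed `σ`: locality of BGSS's pruning — the open point, shared with 13985) + the Green–Kubo tail from the proved
gap. Honours Disproof and the BGK negatives: `∃N₀` (ForallN), `∃ s` (AllWindows: the window threshold is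
load-bearing), `e₁ ⊥ e₂` (Orthogonality / OrthMomentum), window `∝ 1/(σ²√θ)` (TauUniformInSigma). -/
theorem stub_diluteCornerDecay :
    ∀ (a θ : ℝ) (u₀ : V3), 0 < a → 0 < θ →
    ∀ (e₁ e₂ : V3), inner ℝ e₁ e₂ = 0 → ∀ A : ℝ, 0 < A →
    ∀ g : V3 → ℝ, (g = fun w => inner ℝ e₁ w * inner ℝ e₂ w * (1 - Real.smoothTransition (‖w‖ ^ 2 / A ^ 2 - 1))) →
    ∀ r : ℝ, 0 < r → ∃ s : ℝ, 0 < s ∧ ∃ σ₀ : ℝ, 0 < σ₀ ∧ ∀ σ : ℝ, 0 < σ → σ < σ₀ →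
      ∃ N₀ : ℕ, ∀ N : ℕ, N₀ ≤ N → ∀ Φ : HardSphereFlow (Torus.geometry (Fin 3)) (hsDiameter σ N) (N + 1),
        ∫⁻ z, ENNReal.ofReal (((s / (σ ^ 2 * Real.sqrt θ) * ((N + 1 : ℕ) : ℝ) ^ (-(1 / 3 : ℝ)))⁻¹ *
            ∫ r' in (0 : ℝ)..(s / (σ ^ 2 * Real.sqrt θ) * ((N + 1 : ℕ) : ℝ) ^ (-(1 / 3 : ℝ))),
              ∑ i, g ((Real.sqrt θ)⁻¹ • ((Φ.flow r' z i).2 - u₀))) ^ 2)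
          ∂(localGibbsLaw σ (fun _ => a) (fun _ => u₀) (fun _ => θ) N Φ) ≤
        ENNReal.ofReal (r * (((N : ℝ)) + 1) * ∫ v, g v ^ 2 ∂stdGaussian V3) := by
  sorry

/-- **S4 — FROZEN MODULATION at fixed `σ` (first-moment locality; size L).** There is `σ₀(a,θ,u₀)` such that for
`σ < σ₀`, every cutoff stress `g`, every continuous `φ`, every window coefficient `τ` and every `η > 0`, for
`N ≥ N₀(σ,g,φ,τ,η)` and every flow: `V(τ; φ⊗g) ≤ (∫φ²)·V(τ; 1⊗g) + η·(N+1)·∫φ²·‖g‖²_γ` — the modulation cannot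
raise the window fraction. (Two-sided `|V(φ⊗g) − ∫φ²V(1⊗g)| = o(N)` is expected; only this half is consumed.
Degenerate cases are exact: `∫φ² = 0 ⇒ φ ≡ 0 ⇒ V = 0`; `‖g‖_γ = 0 ⇒ g ≡ 0`.) Proof sketch: over a kinetic window
positions move `O(√θ·τℓ) → 0` macroscopically, so `φ(xᵢ(s)) = φ(xᵢ(0)) + o(1)` uniformly (`φ` uniformly
continuous on the compact torus; Maxwellian speed tails under the invariant `G_N`); pair terms `i ≠ j` carry
velocity correlation only through collision chains joining `i` and `j` inside the window, which at fixed `σ` have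
macroscopic reach `o(1)` with `G_N`-probability `1 − o(1)` and uniformly integrable size (the FIRST-MOMENT /
probability form of the route's `InfluenceLocality` 13916, not its LD form), so `φ(xᵢ)φ(xⱼ) = φ(xᵢ)² + o(1)` on
the contributing pairs; far pairs are statically coupled only through the `O(1/N)` canonical (fixed particle
number) correction, whose leading term pairs `g` with a scalar density functional and vanishes by the joint
reflection `(x, v) ↦ (R₁x, R₁v)` under which `g` is odd; the `φ ≡ 1` functional then factors out with weight
`∫φ²` (uniform one-point marginal). `σ₀` only guards the locality input; `N₀` may depend on `φ` — which is what
keeps the crux's `σ₀` `φ`-free. -/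
theorem stub_frozenModulation :
    ∀ (a θ : ℝ) (u₀ : V3), 0 < a → 0 < θ → ∃ σ₀ : ℝ, 0 < σ₀ ∧ ∀ σ : ℝ, 0 < σ → σ < σ₀ →
    ∀ (e₁ e₂ : V3), inner ℝ e₁ e₂ = 0 → ∀ A : ℝ, 0 < A →
    ∀ g : V3 → ℝ, (g = fun w => inner ℝ e₁ w * inner ℝ e₂ w * (1 - Real.smoothTransition (‖w‖ ^ 2 / A ^ 2 - 1))) →
    ∀ φ : T3 → ℝ, Continuous φ → ∀ τ : ℝ, 0 < τ → ∀ η : ℝ, 0 < η →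
      ∃ N₀ : ℕ, ∀ N : ℕ, N₀ ≤ N → ∀ Φ : HardSphereFlow (Torus.geometry (Fin 3)) (hsDiameter σ N) (N + 1),
        ∫⁻ z, ENNReal.ofReal (((τ * ((N + 1 : ℕ) : ℝ) ^ (-(1 / 3 : ℝ)))⁻¹ *
            ∫ s in (0 : ℝ)..(τ * ((N + 1 : ℕ) : ℝ) ^ (-(1 / 3 : ℝ))),
              ∑ i, φ (Φ.flow s z i).1 * g ((Real.sqrt θ)⁻¹ • ((Φ.flow s z i).2 - u₀))) ^ 2)
          ∂(localGibbsLaw σ (fun _ => a) (fun _ => u₀) (fun _ => θ) N Φ) ≤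
        ENNReal.ofReal (∫ x, φ x ^ 2) *
          ∫⁻ z, ENNReal.ofReal (((τ * ((N + 1 : ℕ) : ℝ) ^ (-(1 / 3 : ℝ)))⁻¹ *
            ∫ s in (0 : ℝ)..(τ * ((N + 1 : ℕ) : ℝ) ^ (-(1 / 3 : ℝ))),
              ∑ i, g ((Real.sqrt θ)⁻¹ • ((Φ.flow s z i).2 - u₀))) ^ 2)
          ∂(localGibbsLaw σ (fun _ => a) (fun _ => u₀) (fun _ => θ) N Φ) +
        ENNReal.ofReal (η * (((N : ℝ)) + 1) * (∫ x, φ x ^ 2) * ∫ v, g v ^ 2 ∂stdGaussian V3) := by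
  sorry

/-- **S5 — ABSORPTION CORNER `A → 0` (the genuine residual of the crux: `σ₀` BEFORE `A`; size L).** There are
`A₁ > 0` and `σ₀ > 0` (depending on `a, θ, u₀` only) such that for `σ < σ₀`, every `e₁ ⊥ e₂` and every cutoff
`A ≤ A₁` there is a window `τ` (after `A` and `σ`; `τ ≍ 1/(σ²√θ)`) with: for `N ≥ N₀` and every flow, the `φ ≡ 1`
window second moment of `g_{e₁,e₂,A}` is `≤ ¼·(N+1)‖g‖²_γ`. Mechanism (three proof routes, ONE stub — triage):
(a) this card: `supp g_A ⊂ {|w| ≤ √2·A}`; one collision with a thermal partner removes a near-rest sphere from the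
slow ball (rate `≥ ν(0) = ν̄/√2 = √(8π)/t₀`, tree `TaggedSphereCollisionFrequency.collisionFrequency_zero_pos`),
returns are flux events of small outgoing speed (`O(S·A)` relative, first moment + stationarity, `N`-uniform), and
the distinct (partner) part is `O(A³)` relative (the partner's outgoing velocity must land in the slow ball), so
`c_N(t; ĝ_A) ≤` (`g_A²`-weighted no-collision SURVIVAL of a near-rest tagged sphere, stated conditionally on
`‖w‖ ≤ ρ` for all `ρ ≤ w₀`, triage r1-1 (b); since `τ` is chosen after `A`, survival is needed at ONE slow radius
`w₀(A₁)` only, triage r1-2) `+ O(A³) + o_σ(1)`, and `A₁` is shrunk until the transferred part is `< 1/8`;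
(b) card velocity-resampling-cutoff (S)+(D): sign-split tilt of the tagged datum (sup-norm `R_A ≍ A⁻³` repaid by
the mass `≍ A⁵`) + the exact one-velocity resampling identity, which needs only an `N`-uniform FIRST-MOMENT
forward-cluster bound at fixed `σ` (sibling stubs `MassRelativeTaggedDecay`, `SlowDistinctVanishes`); (c) card
resampling-cascade's REPAIRED `CascadeWindowBound` (with the full clause `g ⊥ span(1, w, |w|²)`, triage r1-2/3).
Why it might fail: trapped slow particles (a plateau of `r_{0.3}(S)` above `½` in MD kills every `∀A`-uniform
line; disprover jobs j008327/8, DSMC j010072 pending on the item). Honours Disproof: `∃N₀`, collisional,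
`e₁ ⊥ e₂`, `τ` after `σ`. It is NOT the crux restricted: `φ ≡ 1`, budget `¼`, and `A₁` is the stub's own choice. -/
theorem stub_absorptionCorner :
    ∀ (a θ : ℝ) (u₀ : V3), 0 < a → 0 < θ → ∃ A₁ : ℝ, 0 < A₁ ∧ ∃ σ₀ : ℝ, 0 < σ₀ ∧ ∀ σ : ℝ, 0 < σ → σ < σ₀ →
    ∀ (e₁ e₂ : V3), inner ℝ e₁ e₂ = 0 → ∀ A : ℝ, 0 < A → A ≤ A₁ →
    ∀ g : V3 → ℝ, (g = fun w => inner ℝ e₁ w * inner ℝ e₂ w * (1 - Real.smoothTransition (‖w‖ ^ 2 / A ^ 2 - 1))) →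
      ∃ τ : ℝ, 0 < τ ∧ ∃ N₀ : ℕ, ∀ N : ℕ, N₀ ≤ N → ∀ Φ : HardSphereFlow (Torus.geometry (Fin 3)) (hsDiameter σ N) (N + 1),
        ∫⁻ z, ENNReal.ofReal (((τ * ((N + 1 : ℕ) : ℝ) ^ (-(1 / 3 : ℝ)))⁻¹ *
            ∫ s in (0 : ℝ)..(τ * ((N + 1 : ℕ) : ℝ) ^ (-(1 / 3 : ℝ))),
              ∑ i, g ((Real.sqrt θ)⁻¹ • ((Φ.flow s z i).2 - u₀))) ^ 2)
          ∂(localGibbsLaw σ (fun _ => a) (fun _ => u₀) (fun _ => θ) N Φ) ≤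
        ENNReal.ofReal ((1 / 4) * (((N : ℝ)) + 1) * ∫ v, g v ^ 2 ∂stdGaussian V3) := by
  sorry

/-! ## Proved helpers (no `sorry` below this line) -/

/-- Cutoff stresses are continuous. -/
theorem continuous_cutoff (e₁ e₂ : V3) (A : ℝ) :
    Continuous (fun w : V3 => inner ℝ e₁ w * inner ℝ e₂ w * (1 - Real.smoothTransition (‖w‖ ^ 2 / A ^ 2 - 1))) := by
  refine ((continuous_const.inner continuous_id).mul (continuous_const.inner continuous_id)).mul
    (continuous_const.sub (Real.smoothTransition.continuous.comp ?_))
  fun_prop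

/-- A cutoff stress vanishes off the ball `‖w‖² ≤ 2A²`. -/
theorem cutoff_eq_zero_of_le {e₁ e₂ : V3} {A : ℝ} (hA : 0 < A) {w : V3} (hw : 2 * A ^ 2 ≤ ‖w‖ ^ 2) :
    inner ℝ e₁ w * inner ℝ e₂ w * (1 - Real.smoothTransition (‖w‖ ^ 2 / A ^ 2 - 1)) = 0 := by
  have hA2 : 0 < A ^ 2 := by positivity
  have h1 : (1 : ℝ) ≤ ‖w‖ ^ 2 / A ^ 2 - 1 := by
    rw [le_sub_iff_add_le, le_div_iff₀ hA2]
    linarith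
  rw [Real.smoothTransition.one_of_one_le h1]
  ring

/-- Cutoff stresses are bounded by `2A²‖e₁‖‖e₂‖`. -/
theorem abs_cutoff_le (e₁ e₂ : V3) {A : ℝ} (hA : 0 < A) (w : V3) :
    |inner ℝ e₁ w * inner ℝ e₂ w * (1 - Real.smoothTransition (‖w‖ ^ 2 / A ^ 2 - 1))| ≤
      2 * A ^ 2 * (‖e₁‖ * ‖e₂‖) := by
  by_cases hw : 2 * A ^ 2 ≤ ‖w‖ ^ 2
  · rw [cutoff_eq_zero_of_le hA hw, abs_zero]
    positivity
  · rw [not_le] at hw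
    have h0 : 0 ≤ Real.smoothTransition (‖w‖ ^ 2 / A ^ 2 - 1) := Real.smoothTransition.nonneg _
    have h1 : Real.smoothTransition (‖w‖ ^ 2 / A ^ 2 - 1) ≤ 1 := Real.smoothTransition.le_one _
    have hi1 : |inner ℝ e₁ w| ≤ ‖e₁‖ * ‖w‖ := abs_real_inner_le_norm e₁ w
    have hi2 : |inner ℝ e₂ w| ≤ ‖e₂‖ * ‖w‖ := abs_real_inner_le_norm e₂ w
    have hcut : |1 - Real.smoothTransition (‖w‖ ^ 2 / A ^ 2 - 1)| ≤ 1 := by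
      rw [abs_le]; constructor <;> linarith
    calc |inner ℝ e₁ w * inner ℝ e₂ w * (1 - Real.smoothTransition (‖w‖ ^ 2 / A ^ 2 - 1))|
        = |inner ℝ e₁ w| * |inner ℝ e₂ w| * |1 - Real.smoothTransition (‖w‖ ^ 2 / A ^ 2 - 1)| := by
          rw [abs_mul, abs_mul]
      _ ≤ (‖e₁‖ * ‖w‖) * (‖e₂‖ * ‖w‖) * 1 := by
          gcongr
      _ = ‖w‖ ^ 2 * (‖e₁‖ * ‖e₂‖) := by ring
      _ ≤ 2 * A ^ 2 * (‖e₁‖ * ‖e₂‖) := by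
          gcongr

/-- A `γ`-integral of a function odd under a linear isometry vanishes (the standard Gaussian is invariant
under linear isometries, `stdGaussian_map`). -/
theorem integral_stdGaussian_eq_zero_of_odd' (R : V3 ≃ₗᵢ[ℝ] V3) {G : V3 → ℝ}
    (hG : ∀ w, G (R w) = -G w) : ∫ w, G w ∂stdGaussian V3 = 0 := by
  have hmp : MeasurePreserving R (stdGaussian V3) (stdGaussian V3) :=
    ⟨R.continuous.measurable, stdGaussian_map R⟩
  have h1 : ∫ w, G (R w) ∂stdGaussian V3 = ∫ w, G w ∂stdGaussian V3 :=
    hmp.integral_comp R.toHomeomorph.measurableEmbedding G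
  simp only [hG, integral_neg] at h1
  linarith

/-- **CENTRING of the cutoff stresses**: for `e₁ ⊥ e₂`, `∫ g_{e₁,e₂,A} dγ = 0` — `g` is odd under the reflection in
the hyperplane `(ℝ∙e₁)ᗮ`, which negates `⟪e₁,·⟫`, fixes `⟪e₂,·⟫` (as `e₂ ⊥ e₁`) and preserves `‖·‖` and `γ`. -/
theorem integral_cutoff_eq_zero {e₁ e₂ : V3} (he : inner ℝ e₁ e₂ = 0) (A : ℝ) :
    ∫ w, inner ℝ e₁ w * inner ℝ e₂ w * (1 - Real.smoothTransition (‖w‖ ^ 2 / A ^ 2 - 1)) ∂stdGaussian V3 = 0 := by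
  by_cases h0 : e₁ = 0
  · simp [h0]
  have hne : (‖e₁‖ : ℝ) ^ 2 ≠ 0 := by
    have : ‖e₁‖ ≠ 0 := norm_ne_zero_iff.2 h0
    positivity
  have he' : ⟪e₂, e₁⟫_ℝ = 0 := by rw [real_inner_comm]; exact he
  refine integral_stdGaussian_eq_zero_of_odd' ((ℝ ∙ e₁)ᗮ.reflection) fun w => ?_
  have h1 : ⟪e₁, (ℝ ∙ e₁)ᗮ.reflection w⟫_ℝ = -⟪e₁, w⟫_ℝ := by
    rw [Submodule.reflection_orthogonal_apply, inner_neg_right, Submodule.reflection_singleton_apply]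
    simp only [RCLike.ofReal_real_eq_id, id_eq, inner_sub_right, inner_add_right, inner_smul_right,
      two_smul, real_inner_self_eq_norm_sq]
    rw [div_mul_cancel₀ _ hne]
    ring
  have h2 : ⟪e₂, (ℝ ∙ e₁)ᗮ.reflection w⟫_ℝ = ⟪e₂, w⟫_ℝ := by
    rw [Submodule.reflection_orthogonal_apply, inner_neg_right, Submodule.reflection_singleton_apply]
    simp only [RCLike.ofReal_real_eq_id, id_eq, inner_sub_right, inner_add_right, inner_smul_right,
      two_smul, he', mul_zero, add_zero, zero_sub, neg_neg]
  rw [h1, h2, LinearIsometryEquiv.norm_map]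
  ring

/-- Scaling of the unmodulated window functional: `V(1 ⊗ c·g) = c² · V(1 ⊗ g)` (linearity of the finite sum and
of the interval integral, `ofReal (c²·x) = ofReal c² · ofReal x`, `lintegral_const_mul'`). -/
theorem lintegral_window_const_mul {Ω : Type*} [MeasurableSpace Ω] (μ : Measure Ω) {n : ℕ}
    (X : ℝ → Ω → Fin n → V3) (h c : ℝ) (g : V3 → ℝ) :
    ∫⁻ z, ENNReal.ofReal ((h⁻¹ * ∫ s in (0 : ℝ)..h, ∑ i, c * g (X s z i)) ^ 2) ∂μ =
      ENNReal.ofReal (c ^ 2) * ∫⁻ z, ENNReal.ofReal ((h⁻¹ * ∫ s in (0 : ℝ)..h, ∑ i, g (X s z i)) ^ 2) ∂μ := by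
  have hpt : ∀ z, (h⁻¹ * ∫ s in (0 : ℝ)..h, ∑ i, c * g (X s z i)) ^ 2 =
      c ^ 2 * (h⁻¹ * ∫ s in (0 : ℝ)..h, ∑ i, g (X s z i)) ^ 2 := by
    intro z
    have : (fun s => ∑ i, c * g (X s z i)) = fun s => c * ∑ i, g (X s z i) := by
      funext s
      rw [Finset.mul_sum]
    rw [this, intervalIntegral.integral_const_mul]
    ring
  simp_rw [hpt, ENNReal.ofReal_mul (sq_nonneg c)]
  rw [lintegral_const_mul' _ _ ENNReal.ofReal_ne_top]

/-- A finite family of positive reals has a positive lower bound. -/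
theorem exists_pos_le_forall {n : ℕ} (f : Fin n → ℝ) (hf : ∀ k, 0 < f k) :
    ∃ m : ℝ, 0 < m ∧ ∀ k, m ≤ f k := by
  induction n with
  | zero => exact ⟨1, one_pos, fun k => k.elim0⟩
  | succ n ih =>
    obtain ⟨m, hm, hmk⟩ := ih (fun k => f k.succ) (fun k => hf k.succ)
    refine ⟨min m (f 0), lt_min hm (hf 0), fun k => ?_⟩
    refine Fin.cases ?_ (fun j => ?_) k
    · exact min_le_right _ _
    · exact (min_le_left _ _).trans (hmk j)

/-! ## Composition (kernel-checked; no `sorry` in this section's proofs) -/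

/-- **The waypoint from S1–S4.** Order of choices, given `(a, θ, u₀, A₁, r)`: `σ_fm` (S4); the net for `[A₁, ∞)`
at relative accuracy `ε = r/8` (S2); for each net point `k` the window `s_k` and `σ_k` of S3 at fraction `r/8`;
`σ₀ := min (1/2, σ_fm, min_k σ_k)`. Given `σ < σ₀`, `e₁ ⊥ e₂`, `A ≥ A₁`, `φ`: S2 gives `k, c`; the window is
`τ := s_k/(σ²√θ)`; S3 gives `V(1⊗g_k) ≤ (r/8)(N+1)‖g_k‖²`; scaling gives `V(1⊗c g_k) = c²V(1⊗g_k)`; S1 at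
`φ ≡ 1, δ = 1` (centring by `integral_cutoff_eq_zero`) gives
`V(1⊗g) ≤ 2c²(r/8)(N+1)‖g_k‖² + 2(N+1)‖g − c g_k‖² ≤ (r/2 + r/4)(N+1)‖g‖²`; S4 at `η = r/4` finishes:
`V(φ⊗g) ≤ ∫φ²·(3r/4)(N+1)‖g‖² + (r/4)(N+1)∫φ²‖g‖² = r(N+1)∫φ²‖g‖²`, with `N₀ := max (N₁, N₂)`. -/
theorem compactRange_of_stubs
    /- S1 = `stub_netLipschitz` -/
    (h₁ : ∀ (σ a θ : ℝ) (u₀ : V3), 0 < σ → σ ≤ 1 / 2 → 0 < a → 0 < θ →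
      ∀ (N : ℕ) (Φ : HardSphereFlow (Torus.geometry (Fin 3)) (hsDiameter σ N) (N + 1)) (h : ℝ), 0 < h →
      ∀ (φ : T3 → ℝ) (g g' : V3 → ℝ), Continuous φ → Continuous g → Continuous g' →
        (∃ K : ℝ, ∀ v, |g v| ≤ K) → (∃ K : ℝ, ∀ v, |g' v| ≤ K) →
        ∫ v, g v ∂stdGaussian V3 = 0 → ∫ v, g' v ∂stdGaussian V3 = 0 →
      ∀ δ : ℝ, 0 < δ →
        ∫⁻ z, ENNReal.ofReal ((h⁻¹ * ∫ s in (0 : ℝ)..h,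
            ∑ i, φ (Φ.flow s z i).1 * g ((Real.sqrt θ)⁻¹ • ((Φ.flow s z i).2 - u₀))) ^ 2)
          ∂(localGibbsLaw σ (fun _ => a) (fun _ => u₀) (fun _ => θ) N Φ) ≤
        ENNReal.ofReal (1 + δ) *
          ∫⁻ z, ENNReal.ofReal ((h⁻¹ * ∫ s in (0 : ℝ)..h,
            ∑ i, φ (Φ.flow s z i).1 * g' ((Real.sqrt θ)⁻¹ • ((Φ.flow s z i).2 - u₀))) ^ 2)
          ∂(localGibbsLaw σ (fun _ => a) (fun _ => u₀) (fun _ => θ) N Φ) +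
        ENNReal.ofReal ((1 + δ⁻¹) * (((N : ℝ)) + 1) * (∫ x, φ x ^ 2) *
          ∫ v, (g v - g' v) ^ 2 ∂stdGaussian V3))
    /- S2 = `stub_cutoffNet` -/
    (h₂ : ∀ A₁ : ℝ, 0 < A₁ → ∀ ε : ℝ, 0 < ε →
      ∃ (n : ℕ) (E₁ E₂ : Fin n → V3) (Ac : Fin n → ℝ),
        (∀ k, inner ℝ (E₁ k) (E₂ k) = 0 ∧ 0 < Ac k) ∧
        ∀ (e₁ e₂ : V3), inner ℝ e₁ e₂ = 0 → ∀ A : ℝ, A₁ ≤ A →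
        ∀ g : V3 → ℝ, (g = fun w => inner ℝ e₁ w * inner ℝ e₂ w * (1 - Real.smoothTransition (‖w‖ ^ 2 / A ^ 2 - 1))) →
          ∃ (k : Fin n) (c : ℝ),
            ∫ v, (g v - c * (inner ℝ (E₁ k) v * inner ℝ (E₂ k) v *
                (1 - Real.smoothTransition (‖v‖ ^ 2 / (Ac k) ^ 2 - 1)))) ^ 2 ∂stdGaussian V3 ≤
              ε * ∫ v, g v ^ 2 ∂stdGaussian V3 ∧
            c ^ 2 * ∫ v, (inner ℝ (E₁ k) v * inner ℝ (E₂ k) v *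
                (1 - Real.smoothTransition (‖v‖ ^ 2 / (Ac k) ^ 2 - 1))) ^ 2 ∂stdGaussian V3 ≤
              2 * ∫ v, g v ^ 2 ∂stdGaussian V3)
    /- S3 = `stub_diluteCornerDecay` -/
    (h₃ : ∀ (a θ : ℝ) (u₀ : V3), 0 < a → 0 < θ →
      ∀ (e₁ e₂ : V3), inner ℝ e₁ e₂ = 0 → ∀ A : ℝ, 0 < A →
      ∀ g : V3 → ℝ, (g = fun w => inner ℝ e₁ w * inner ℝ e₂ w * (1 - Real.smoothTransition (‖w‖ ^ 2 / A ^ 2 - 1))) →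
      ∀ r : ℝ, 0 < r → ∃ s : ℝ, 0 < s ∧ ∃ σ₀ : ℝ, 0 < σ₀ ∧ ∀ σ : ℝ, 0 < σ → σ < σ₀ →
        ∃ N₀ : ℕ, ∀ N : ℕ, N₀ ≤ N → ∀ Φ : HardSphereFlow (Torus.geometry (Fin 3)) (hsDiameter σ N) (N + 1),
          ∫⁻ z, ENNReal.ofReal (((s / (σ ^ 2 * Real.sqrt θ) * ((N + 1 : ℕ) : ℝ) ^ (-(1 / 3 : ℝ)))⁻¹ *
              ∫ r' in (0 : ℝ)..(s / (σ ^ 2 * Real.sqrt θ) * ((N + 1 : ℕ) : ℝ) ^ (-(1 / 3 : ℝ))),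
                ∑ i, g ((Real.sqrt θ)⁻¹ • ((Φ.flow r' z i).2 - u₀))) ^ 2)
            ∂(localGibbsLaw σ (fun _ => a) (fun _ => u₀) (fun _ => θ) N Φ) ≤
          ENNReal.ofReal (r * (((N : ℝ)) + 1) * ∫ v, g v ^ 2 ∂stdGaussian V3))
    /- S4 = `stub_frozenModulation` -/
    (h₄ : ∀ (a θ : ℝ) (u₀ : V3), 0 < a → 0 < θ → ∃ σ₀ : ℝ, 0 < σ₀ ∧ ∀ σ : ℝ, 0 < σ → σ < σ₀ →
      ∀ (e₁ e₂ : V3), inner ℝ e₁ e₂ = 0 → ∀ A : ℝ, 0 < A →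
      ∀ g : V3 → ℝ, (g = fun w => inner ℝ e₁ w * inner ℝ e₂ w * (1 - Real.smoothTransition (‖w‖ ^ 2 / A ^ 2 - 1))) →
      ∀ φ : T3 → ℝ, Continuous φ → ∀ τ : ℝ, 0 < τ → ∀ η : ℝ, 0 < η →
        ∃ N₀ : ℕ, ∀ N : ℕ, N₀ ≤ N → ∀ Φ : HardSphereFlow (Torus.geometry (Fin 3)) (hsDiameter σ N) (N + 1),
          ∫⁻ z, ENNReal.ofReal (((τ * ((N + 1 : ℕ) : ℝ) ^ (-(1 / 3 : ℝ)))⁻¹ *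
              ∫ s in (0 : ℝ)..(τ * ((N + 1 : ℕ) : ℝ) ^ (-(1 / 3 : ℝ))),
                ∑ i, φ (Φ.flow s z i).1 * g ((Real.sqrt θ)⁻¹ • ((Φ.flow s z i).2 - u₀))) ^ 2)
            ∂(localGibbsLaw σ (fun _ => a) (fun _ => u₀) (fun _ => θ) N Φ) ≤
          ENNReal.ofReal (∫ x, φ x ^ 2) *
            ∫⁻ z, ENNReal.ofReal (((τ * ((N + 1 : ℕ) : ℝ) ^ (-(1 / 3 : ℝ)))⁻¹ *
              ∫ s in (0 : ℝ)..(τ * ((N + 1 : ℕ) : ℝ) ^ (-(1 / 3 : ℝ))),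
                ∑ i, g ((Real.sqrt θ)⁻¹ • ((Φ.flow s z i).2 - u₀))) ^ 2)
            ∂(localGibbsLaw σ (fun _ => a) (fun _ => u₀) (fun _ => θ) N Φ) +
          ENNReal.ofReal (η * (((N : ℝ)) + 1) * (∫ x, φ x ^ 2) * ∫ v, g v ^ 2 ∂stdGaussian V3))
    :
    /- the COMPACT-RANGE WAYPOINT: any budget `r` on `A ≥ A₁`, `σ₀` before `e₁, e₂, A, φ` -/
    ∀ (a θ : ℝ) (u₀ : V3), 0 < a → 0 < θ → ∀ A₁ : ℝ, 0 < A₁ → ∀ r : ℝ, 0 < r →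
    ∃ σ₀ : ℝ, 0 < σ₀ ∧ ∀ σ : ℝ, 0 < σ → σ < σ₀ →
    ∀ (e₁ e₂ : V3), inner ℝ e₁ e₂ = 0 → ∀ A : ℝ, A₁ ≤ A →
    ∀ g : V3 → ℝ, (g = fun w => inner ℝ e₁ w * inner ℝ e₂ w * (1 - Real.smoothTransition (‖w‖ ^ 2 / A ^ 2 - 1))) →
    ∀ φ : T3 → ℝ, Continuous φ →
      ∃ τ : ℝ, 0 < τ ∧ ∃ N₀ : ℕ, ∀ N : ℕ, N₀ ≤ N → ∀ Φ : HardSphereFlow (Torus.geometry (Fin 3)) (hsDiameter σ N) (N + 1),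
        ∫⁻ z, ENNReal.ofReal (((τ * ((N + 1 : ℕ) : ℝ) ^ (-(1 / 3 : ℝ)))⁻¹ *
            ∫ s in (0 : ℝ)..(τ * ((N + 1 : ℕ) : ℝ) ^ (-(1 / 3 : ℝ))),
              ∑ i, φ (Φ.flow s z i).1 * g ((Real.sqrt θ)⁻¹ • ((Φ.flow s z i).2 - u₀))) ^ 2)
          ∂(localGibbsLaw σ (fun _ => a) (fun _ => u₀) (fun _ => θ) N Φ) ≤
        ENNReal.ofReal (r * (((N : ℝ)) + 1) * (∫ x, φ x ^ 2) * ∫ v, g v ^ 2 ∂stdGaussian V3) := by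
  intro a θ u₀ ha hθ A₁ hA₁ r hr
  -- S4: frozen modulation threshold
  obtain ⟨σfm, hσfm, hfm⟩ := h₄ a θ u₀ ha hθ
  -- S2: the finite net on `[A₁, ∞)` at relative accuracy `r/8`
  obtain ⟨n, E₁, E₂, Ac, hnet, hcover⟩ := h₂ A₁ hA₁ (r / 8) (by positivity)
  -- S3 at every net point, fraction `r/8`
  have hdec : ∀ k : Fin n, ∃ s : ℝ, 0 < s ∧ ∃ σ₀ : ℝ, 0 < σ₀ ∧ ∀ σ : ℝ, 0 < σ → σ < σ₀ →
      ∃ N₀ : ℕ, ∀ N : ℕ, N₀ ≤ N → ∀ Φ : HardSphereFlow (Torus.geometry (Fin 3)) (hsDiameter σ N) (N + 1),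
        ∫⁻ z, ENNReal.ofReal (((s / (σ ^ 2 * Real.sqrt θ) * ((N + 1 : ℕ) : ℝ) ^ (-(1 / 3 : ℝ)))⁻¹ *
            ∫ r' in (0 : ℝ)..(s / (σ ^ 2 * Real.sqrt θ) * ((N + 1 : ℕ) : ℝ) ^ (-(1 / 3 : ℝ))),
              ∑ i, (fun w => inner ℝ (E₁ k) w * inner ℝ (E₂ k) w *
                (1 - Real.smoothTransition (‖w‖ ^ 2 / (Ac k) ^ 2 - 1)))
                ((Real.sqrt θ)⁻¹ • ((Φ.flow r' z i).2 - u₀))) ^ 2)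
          ∂(localGibbsLaw σ (fun _ => a) (fun _ => u₀) (fun _ => θ) N Φ) ≤
        ENNReal.ofReal ((r / 8) * (((N : ℝ)) + 1) * ∫ v, (fun w => inner ℝ (E₁ k) w * inner ℝ (E₂ k) w *
                (1 - Real.smoothTransition (‖w‖ ^ 2 / (Ac k) ^ 2 - 1))) v ^ 2 ∂stdGaussian V3) :=
    fun k => h₃ a θ u₀ ha hθ (E₁ k) (E₂ k) (hnet k).1 (Ac k) (hnet k).2 _ rfl (r / 8) (by positivity)
  choose s hs σk hσk hdec' using hdec
  obtain ⟨m, hm, hmk⟩ := exists_pos_le_forall σk hσk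
  -- the density threshold of the waypoint
  refine ⟨min (1 / 2) (min σfm m), lt_min (by norm_num) (lt_min hσfm hm), fun σ hσ hσlt => ?_⟩
  have hσhalf : σ ≤ 1 / 2 := (hσlt.trans_le (min_le_left _ _)).le
  have hσf : σ < σfm := hσlt.trans_le ((min_le_right _ _).trans (min_le_left _ _))
  have hσm : ∀ k, σ < σk k := fun k =>
    (hσlt.trans_le ((min_le_right _ _).trans (min_le_right _ _))).trans_le (hmk k)
  intro e₁ e₂ he A hA₁A g hg φ hφ
  have hA : 0 < A := hA₁.trans_le hA₁A
  -- nonnegativity of the static constants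
  have hG0 : 0 ≤ ∫ v, g v ^ 2 ∂stdGaussian V3 := integral_nonneg fun v => sq_nonneg _
  have hφ0 : 0 ≤ ∫ x, φ x ^ 2 := integral_nonneg fun x => sq_nonneg _
  -- S2, S3, scaling, S1 at `φ ≡ 1`, then S4
  obtain ⟨k, c, hdist, hnorm⟩ := hcover e₁ e₂ he A hA₁A g hg
  obtain ⟨N₁, hN₁⟩ := hdec' k σ hσ (hσm k)
  have hτ : 0 < s k / (σ ^ 2 * Real.sqrt θ) := by
    have := hs k
    have : 0 < Real.sqrt θ := Real.sqrt_pos.2 hθ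
    positivity
  obtain ⟨N₂, hN₂⟩ := hfm σ hσ hσf e₁ e₂ he A hA g hg φ hφ _ hτ (r / 4) (by positivity)
  refine ⟨s k / (σ ^ 2 * Real.sqrt θ), hτ, max N₁ N₂, fun N hN Φ => ?_⟩
  have h3 := hN₁ N (le_of_max_le_left hN) Φ
  have h4 := hN₂ N (le_of_max_le_right hN) Φ
  beta_reduce at h3
  have hN0 : (0 : ℝ) < (N : ℝ) + 1 := by positivity
  -- the window and its positivity
  set hw : ℝ := s k / (σ ^ 2 * Real.sqrt θ) * ((N + 1 : ℕ) : ℝ) ^ (-(1 / 3 : ℝ)) with hhw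
  have hhwpos : 0 < hw := mul_pos hτ (Real.rpow_pos_of_pos (by positivity) _)
  -- hypotheses of S1 for `g` and `c • g_k`
  have hgc : Continuous g := by rw [hg]; exact continuous_cutoff e₁ e₂ A
  have hgkc : Continuous fun v : V3 => c * (inner ℝ (E₁ k) v * inner ℝ (E₂ k) v *
      (1 - Real.smoothTransition (‖v‖ ^ 2 / (Ac k) ^ 2 - 1))) :=
    continuous_const.mul (continuous_cutoff (E₁ k) (E₂ k) (Ac k))
  have hgb : ∃ K : ℝ, ∀ v, |g v| ≤ K :=
    ⟨2 * A ^ 2 * (‖e₁‖ * ‖e₂‖), fun v => by rw [hg]; exact abs_cutoff_le e₁ e₂ hA v⟩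
  have hgkb : ∃ K : ℝ, ∀ v : V3, |c * (inner ℝ (E₁ k) v * inner ℝ (E₂ k) v *
      (1 - Real.smoothTransition (‖v‖ ^ 2 / (Ac k) ^ 2 - 1)))| ≤ K :=
    ⟨|c| * (2 * (Ac k) ^ 2 * (‖E₁ k‖ * ‖E₂ k‖)), fun v => by
      rw [abs_mul]
      exact mul_le_mul_of_nonneg_left (abs_cutoff_le (E₁ k) (E₂ k) (hnet k).2 v) (abs_nonneg c)⟩
  have hg0 : ∫ v, g v ∂stdGaussian V3 = 0 := by rw [hg]; exact integral_cutoff_eq_zero he A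
  have hgk0 : ∫ v : V3, c * (inner ℝ (E₁ k) v * inner ℝ (E₂ k) v *
      (1 - Real.smoothTransition (‖v‖ ^ 2 / (Ac k) ^ 2 - 1))) ∂stdGaussian V3 = 0 := by
    rw [integral_const_mul, integral_cutoff_eq_zero (hnet k).1 (Ac k), mul_zero]
  -- S1 at `φ ≡ 1`, `δ = 1`
  have h1 := h₁ σ a θ u₀ hσ hσhalf ha hθ N Φ hw hhwpos (fun _ => (1 : ℝ)) g
    (fun v => c * (inner ℝ (E₁ k) v * inner ℝ (E₂ k) v *
      (1 - Real.smoothTransition (‖v‖ ^ 2 / (Ac k) ^ 2 - 1)))) continuous_const hgc hgkc hgb hgkb hg0 hgk0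
    1 one_pos
  have hT3 : (∫ x : T3, (1 : ℝ) ^ 2) = 1 := by simp
  simp only [one_mul] at h1
  rw [hT3, mul_one] at h1
  -- scaling `V(1 ⊗ c g_k) = c² V(1 ⊗ g_k)`
  have hsc := lintegral_window_const_mul (localGibbsLaw σ (fun _ => a) (fun _ => u₀) (fun _ => θ) N Φ)
    (fun s' z i => (Real.sqrt θ)⁻¹ • ((Φ.flow s' z i).2 - u₀)) hw c
    (fun v => inner ℝ (E₁ k) v * inner ℝ (E₂ k) v * (1 - Real.smoothTransition (‖v‖ ^ 2 / (Ac k) ^ 2 - 1)))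
  beta_reduce at hsc
  rw [hsc] at h1
  -- nonnegativity of the net point's static constants
  have hGk0 : 0 ≤ ∫ v : V3, (inner ℝ (E₁ k) v * inner ℝ (E₂ k) v *
      (1 - Real.smoothTransition (‖v‖ ^ 2 / (Ac k) ^ 2 - 1))) ^ 2 ∂stdGaussian V3 :=
    integral_nonneg fun v => sq_nonneg _
  have hD0 : 0 ≤ ∫ v : V3, (g v - c * (inner ℝ (E₁ k) v * inner ℝ (E₂ k) v *
      (1 - Real.smoothTransition (‖v‖ ^ 2 / (Ac k) ^ 2 - 1)))) ^ 2 ∂stdGaussian V3 :=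
    integral_nonneg fun v => sq_nonneg _
  -- the static comparison `V(1 ⊗ g) ≤ (3r/4) (N+1) ‖g‖²`
  have hV1 : ∫⁻ z, ENNReal.ofReal ((hw⁻¹ * ∫ s' in (0 : ℝ)..hw,
        ∑ i, g ((Real.sqrt θ)⁻¹ • ((Φ.flow s' z i).2 - u₀))) ^ 2)
      ∂(localGibbsLaw σ (fun _ => a) (fun _ => u₀) (fun _ => θ) N Φ) ≤
      ENNReal.ofReal ((3 / 4 * r) * (((N : ℝ)) + 1) * ∫ v, g v ^ 2 ∂stdGaussian V3) := by
    refine h1.trans ?_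
    refine (add_le_add (mul_le_mul_of_nonneg_left (mul_le_mul_of_nonneg_left h3 zero_le)
      zero_le) le_rfl).trans ?_
    rw [← ENNReal.ofReal_mul (sq_nonneg c), ← ENNReal.ofReal_mul (by norm_num : (0 : ℝ) ≤ 1 + 1),
      ← ENNReal.ofReal_add (by positivity) (by positivity)]
    refine ENNReal.ofReal_le_ofReal ?_
    have hc' := mul_le_mul_of_nonneg_left hnorm hN0.le
    have hd' := mul_le_mul_of_nonneg_left hdist hN0.le
    have hc'' := mul_le_mul_of_nonneg_left hc' hr.le
    nlinarith [hc', hd', hc'', hG0, hN0, hGk0, hD0, sq_nonneg c, hr]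
  -- S4 finishes
  calc _ ≤ _ := h4
    _ ≤ ENNReal.ofReal (∫ x, φ x ^ 2) *
          ENNReal.ofReal ((3 / 4 * r) * (((N : ℝ)) + 1) * ∫ v, g v ^ 2 ∂stdGaussian V3) +
        ENNReal.ofReal ((r / 4) * (((N : ℝ)) + 1) * (∫ x, φ x ^ 2) * ∫ v, g v ^ 2 ∂stdGaussian V3) := by
        gcongr
    _ = ENNReal.ofReal (r * (((N : ℝ)) + 1) * (∫ x, φ x ^ 2) * ∫ v, g v ^ 2 ∂stdGaussian V3) := by
        rw [← ENNReal.ofReal_mul hφ0, ← ENNReal.ofReal_add (by positivity) (by positivity)]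
        congr 1
        ring

/-- **The corner from S4 + S5 (hypothesis form; `sorry`-free).** `A₁, σ_abs` from S5, `σ_fm` from S4,
`σ₀ := min (σ_abs, σ_fm)`; given `σ, e₁ ⊥ e₂, A ≤ A₁, φ`: S5 gives `τ, N₁` with `V(τ; 1⊗g) ≤ ¼(N+1)‖g‖²`, S4 at
`η = ¼` gives `N₂`, and `V(τ; φ⊗g) ≤ ∫φ²·¼(N+1)‖g‖² + ¼(N+1)∫φ²‖g‖² = ½(N+1)∫φ²‖g‖²` for `N ≥ max (N₁, N₂)`. -/
theorem cornerHalf_of_stubs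
    /- S4 = `stub_frozenModulation` -/
    (h₄ : ∀ (a θ : ℝ) (u₀ : V3), 0 < a → 0 < θ → ∃ σ₀ : ℝ, 0 < σ₀ ∧ ∀ σ : ℝ, 0 < σ → σ < σ₀ →
      ∀ (e₁ e₂ : V3), inner ℝ e₁ e₂ = 0 → ∀ A : ℝ, 0 < A →
      ∀ g : V3 → ℝ, (g = fun w => inner ℝ e₁ w * inner ℝ e₂ w * (1 - Real.smoothTransition (‖w‖ ^ 2 / A ^ 2 - 1))) →
      ∀ φ : T3 → ℝ, Continuous φ → ∀ τ : ℝ, 0 < τ → ∀ η : ℝ, 0 < η →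
        ∃ N₀ : ℕ, ∀ N : ℕ, N₀ ≤ N → ∀ Φ : HardSphereFlow (Torus.geometry (Fin 3)) (hsDiameter σ N) (N + 1),
          ∫⁻ z, ENNReal.ofReal (((τ * ((N + 1 : ℕ) : ℝ) ^ (-(1 / 3 : ℝ)))⁻¹ *
              ∫ s in (0 : ℝ)..(τ * ((N + 1 : ℕ) : ℝ) ^ (-(1 / 3 : ℝ))),
                ∑ i, φ (Φ.flow s z i).1 * g ((Real.sqrt θ)⁻¹ • ((Φ.flow s z i).2 - u₀))) ^ 2)
            ∂(localGibbsLaw σ (fun _ => a) (fun _ => u₀) (fun _ => θ) N Φ) ≤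
          ENNReal.ofReal (∫ x, φ x ^ 2) *
            ∫⁻ z, ENNReal.ofReal (((τ * ((N + 1 : ℕ) : ℝ) ^ (-(1 / 3 : ℝ)))⁻¹ *
              ∫ s in (0 : ℝ)..(τ * ((N + 1 : ℕ) : ℝ) ^ (-(1 / 3 : ℝ))),
                ∑ i, g ((Real.sqrt θ)⁻¹ • ((Φ.flow s z i).2 - u₀))) ^ 2)
            ∂(localGibbsLaw σ (fun _ => a) (fun _ => u₀) (fun _ => θ) N Φ) +
          ENNReal.ofReal (η * (((N : ℝ)) + 1) * (∫ x, φ x ^ 2) * ∫ v, g v ^ 2 ∂stdGaussian V3))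
    /- S5 = `stub_absorptionCorner` -/
    (h₅ : ∀ (a θ : ℝ) (u₀ : V3), 0 < a → 0 < θ → ∃ A₁ : ℝ, 0 < A₁ ∧ ∃ σ₀ : ℝ, 0 < σ₀ ∧ ∀ σ : ℝ, 0 < σ → σ < σ₀ →
      ∀ (e₁ e₂ : V3), inner ℝ e₁ e₂ = 0 → ∀ A : ℝ, 0 < A → A ≤ A₁ →
      ∀ g : V3 → ℝ, (g = fun w => inner ℝ e₁ w * inner ℝ e₂ w * (1 - Real.smoothTransition (‖w‖ ^ 2 / A ^ 2 - 1))) →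
        ∃ τ : ℝ, 0 < τ ∧ ∃ N₀ : ℕ, ∀ N : ℕ, N₀ ≤ N → ∀ Φ : HardSphereFlow (Torus.geometry (Fin 3)) (hsDiameter σ N) (N + 1),
          ∫⁻ z, ENNReal.ofReal (((τ * ((N + 1 : ℕ) : ℝ) ^ (-(1 / 3 : ℝ)))⁻¹ *
              ∫ s in (0 : ℝ)..(τ * ((N + 1 : ℕ) : ℝ) ^ (-(1 / 3 : ℝ))),
                ∑ i, g ((Real.sqrt θ)⁻¹ • ((Φ.flow s z i).2 - u₀))) ^ 2)
            ∂(localGibbsLaw σ (fun _ => a) (fun _ => u₀) (fun _ => θ) N Φ) ≤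
          ENNReal.ofReal ((1 / 4) * (((N : ℝ)) + 1) * ∫ v, g v ^ 2 ∂stdGaussian V3))
    :
    /- the CORNER WAYPOINT: the crux's bound `½` for `A ≤ A₁` and every `φ` -/
    ∀ (a θ : ℝ) (u₀ : V3), 0 < a → 0 < θ → ∃ A₁ : ℝ, 0 < A₁ ∧ ∃ σ₀ : ℝ, 0 < σ₀ ∧ ∀ σ : ℝ, 0 < σ → σ < σ₀ →
    ∀ (e₁ e₂ : V3), inner ℝ e₁ e₂ = 0 → ∀ A : ℝ, 0 < A → A ≤ A₁ →
    ∀ g : V3 → ℝ, (g = fun w => inner ℝ e₁ w * inner ℝ e₂ w * (1 - Real.smoothTransition (‖w‖ ^ 2 / A ^ 2 - 1))) →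
    ∀ φ : T3 → ℝ, Continuous φ →
      ∃ τ : ℝ, 0 < τ ∧ ∃ N₀ : ℕ, ∀ N : ℕ, N₀ ≤ N → ∀ Φ : HardSphereFlow (Torus.geometry (Fin 3)) (hsDiameter σ N) (N + 1),
        ∫⁻ z, ENNReal.ofReal (((τ * ((N + 1 : ℕ) : ℝ) ^ (-(1 / 3 : ℝ)))⁻¹ *
            ∫ s in (0 : ℝ)..(τ * ((N + 1 : ℕ) : ℝ) ^ (-(1 / 3 : ℝ))),
              ∑ i, φ (Φ.flow s z i).1 * g ((Real.sqrt θ)⁻¹ • ((Φ.flow s z i).2 - u₀))) ^ 2)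
          ∂(localGibbsLaw σ (fun _ => a) (fun _ => u₀) (fun _ => θ) N Φ) ≤
        ENNReal.ofReal ((1 / 2) * (((N : ℝ)) + 1) * (∫ x, φ x ^ 2) * ∫ v, g v ^ 2 ∂stdGaussian V3) := by
  intro a θ u₀ ha hθ
  obtain ⟨A₁, hA₁, σabs, hσabs, habs⟩ := h₅ a θ u₀ ha hθ
  obtain ⟨σfm, hσfm, hfm⟩ := h₄ a θ u₀ ha hθ
  refine ⟨A₁, hA₁, min σabs σfm, lt_min hσabs hσfm, fun σ hσ hσlt => ?_⟩
  have hσa : σ < σabs := hσlt.trans_le (min_le_left _ _)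
  have hσf : σ < σfm := hσlt.trans_le (min_le_right _ _)
  intro e₁ e₂ he A hA hAle g hg φ hφ
  have hG0 : 0 ≤ ∫ v, g v ^ 2 ∂stdGaussian V3 := integral_nonneg fun v => sq_nonneg _
  have hφ0 : 0 ≤ ∫ x, φ x ^ 2 := integral_nonneg fun x => sq_nonneg _
  obtain ⟨τ, hτ, N₁, hN₁⟩ := habs σ hσ hσa e₁ e₂ he A hA hAle g hg
  obtain ⟨N₂, hN₂⟩ := hfm σ hσ hσf e₁ e₂ he A hA g hg φ hφ τ hτ (1 / 4) (by norm_num)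
  refine ⟨τ, hτ, max N₁ N₂, fun N hN Φ => ?_⟩
  have h5 := hN₁ N (le_of_max_le_left hN) Φ
  have h4 := hN₂ N (le_of_max_le_right hN) Φ
  have hN0 : (0 : ℝ) < (N : ℝ) + 1 := by positivity
  calc _ ≤ _ := h4
    _ ≤ ENNReal.ofReal (∫ x, φ x ^ 2) *
          ENNReal.ofReal ((1 / 4) * (((N : ℝ)) + 1) * ∫ v, g v ^ 2 ∂stdGaussian V3) +
        ENNReal.ofReal ((1 / 4) * (((N : ℝ)) + 1) * (∫ x, φ x ^ 2) * ∫ v, g v ^ 2 ∂stdGaussian V3) := by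
        gcongr
    _ = ENNReal.ofReal ((1 / 2) * (((N : ℝ)) + 1) * (∫ x, φ x ^ 2) * ∫ v, g v ^ 2 ∂stdGaussian V3) := by
        rw [← ENNReal.ofReal_mul hφ0, ← ENNReal.ofReal_add (by positivity) (by positivity)]
        congr 1
        ring

/-- **The audited composition: `ShearStressHalfDrude` (the route decl, BY NAME) from the five REGISTERED stubs.**
It is the ONLY declaration of this file concluding the crux, takes no hypotheses, and its only non-whitelisted
axiom is `sorryAx`, entering exclusively through `stub_*` (every other ingredient — the two waypoints
`compactRange_of_stubs`, `cornerHalf_of_stubs` and the helpers — is `sorry`-free); elaborating this term also makes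
the kernel certify that each waypoint hypothesis is, token for token, the registered `stub_*` signature.
Order of choices: `A₁, σ_co` from the corner waypoint (S4, S5); `σ_cr := σ₀(a,θ,u₀,A₁,½)` from the compact-range
waypoint (S1–S4); `σ₀ := min (1/2, σ_co, σ_cr)` — chosen before `e₁, e₂, A, φ`, as the crux demands; then
`A ≤ A₁` is the corner and `A₁ < A` the compact range, verbatim. The probability clause is the tree's
`isProbabilityMeasure_localGibbsLaw` (`σ ≤ 1/2`). -/
theorem ShearStressHalfDrude_of : ShearStressHalfDrude := by
  intro a θ u₀ ha hθ
  obtain ⟨A₁, hA₁, σco, hσco, hco⟩ :=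
    cornerHalf_of_stubs stub_frozenModulation stub_absorptionCorner a θ u₀ ha hθ
  obtain ⟨σcr, hσcr, hcr⟩ :=
    compactRange_of_stubs stub_netLipschitz stub_cutoffNet stub_diluteCornerDecay stub_frozenModulation
      a θ u₀ ha hθ A₁ hA₁ (1 / 2) (by norm_num)
  refine ⟨min (1 / 2) (min σco σcr), lt_min (by norm_num) (lt_min hσco hσcr), fun σ hσ hσlt => ?_⟩
  have hσhalf : σ ≤ 1 / 2 := (hσlt.trans_le (min_le_left _ _)).le
  have hσo : σ < σco := hσlt.trans_le ((min_le_right _ _).trans (min_le_left _ _))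
  have hσc : σ < σcr := hσlt.trans_le ((min_le_right _ _).trans (min_le_right _ _))
  refine ⟨fun N Φ => isProbabilityMeasure_localGibbsLaw continuous_const continuous_const continuous_const
    (fun _ => ha) (fun _ => hθ) hσhalf N Φ, ?_⟩
  intro e₁ e₂ he A hA g hg φ hφ
  rcases le_or_gt A A₁ with hAle | hAgt
  · exact hco σ hσ hσo e₁ e₂ he A hA hAle g hg φ hφ
  · exact hcr σ hσ hσc e₁ e₂ he A hAgt.le g hg φ hφ

/-! ## Landed negative lemmas in scope (imported above): no stub is an instance they refute -/

/-- `Negative/FalseForAllN`: the `∀ N` strengthening of the crux is FALSE (one free sphere). Honoured: S3, S4, S5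
conclude `∃ N₀ ∀ N ≥ N₀`; S1, S2 claim no decay. -/
example : ¬ Literature.Uncategorized.ShearStressHalfDrudeAllN :=
  Summit.AtomisticToContinuum.HydrodynamicLimit.Theorems.ShearStressHalfDrudeOneSphere.not_shearStressHalfDrudeAllN

/-- `Negative/WithoutOrth`: the crux without `e₁ ⊥ e₂` is FALSE (centring load-bearing). Honoured: S2–S5 carry
`inner ℝ e₁ e₂ = 0`, S1 carries `∫ g dγ = ∫ g' dγ = 0`, and the composition proves centring (`integral_cutoff_eq_zero`). -/
example : ¬ Summit.AtomisticToContinuum.HydrodynamicLimit.Theorems.ShearStressHalfDrudeWithoutOrth :=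
  Summit.AtomisticToContinuum.HydrodynamicLimit.Theorems.ShearStressHalfDrudeNonCentred.shearStressHalfDrudeWithoutOrth_false

end Summit.AtomisticToContinuum.HydrodynamicLimit.Cruxes.ShearStressHalfDrude.CutoffCompactnessNet

end
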